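import Mathlib
import HarnessLib
import Summits.HubbardSuperconductivity.HubbardSuperconductivity.Theorems.KLProgrammeKLRegimeEngineTowerRemeasureWt
import Summits.HubbardSuperconductivity.HubbardSuperconductivity.Theorems.KLProgrammeKLRegimeEngineTowerModelDefsRate
import Summits.HubbardSuperconductivity.HubbardSuperconductivity.Theorems.KLProgrammeKLRegimeEngineTowerModelDefs

/-!
# Route `KLProgramme` — crux K3 ENGINE (stmt-HubbardSuperconductivity-20437 `KLRegimeEngineV17F2`), stub (b) v2, THE LEVELS PACKAGE (ℓ):
# instantiation (I1), weighted ALL-KNOWN track — the WEIGHTED PRESCRIBED input sizes `hB` of the all-known rows served by the ONE-PINNED measured arrays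
# (`klTowerMeasWtAt` for blocks `k ≥ 1`, `klTowerUVWt` for block `0`): prescribing more labels only drops terms
# (cell gate-hubbard-kl, seat hubbard-kl-k3c2-p3 g12 as SUBSTITUTE typer while the E1 lineage is unseated — E1 may rename or supersede)

The all-known rows (`pinnedTupleWtSum_klTowerIncr_le`, `klTowerBornWtFull_le_kit(_units)`, block `0`: `pinnedTupleWtSum_klTowerIncr_zero_le_kit`,
`klTowerBornWtFull_zero_le_kit(_units)`) read their input through a WEIGHTED PRESCRIBED size hypothesis
  `hB : q ∈ E → E.card = Fc + 1 → ε^{2m′+1}·Σ_{σ : σ|_E = τ|_E} Σ_{x : x q = y} klScaleWt_j(latticeLegPos ∘ (x, σ))·‖W^{F}_σ(G)(x)‖ ≤ B (m′+1) Fc`,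
for which no measured carrier exists.  None is needed: the prescribed sum is a SUB-SUM of the one-pinned sum at the pin `(y, τ q)` (only the pinned leg's label kept),
which is the rate-`j` weighted pinned sum `klWtPinnedSumAt … j (2m′+2) G q (y, τ q)` of E1's …ModelDefsRate (blocks `k ≥ 1`, family `F_{dk−1}`) resp. E1's UV datum
`klTowerUVWt` (block `0`, trivial family, rate `0 ≤ J′`).  So `B (m′+1) Fc := klTowerMeasWtAt … d k j (2m′+2)` resp. `klTowerUVWt … (2m′+2)` serve EVERY `Fc`
(the instantiator then books the parents factor `27^c`, `c ≤ 2m′+1`, into the kit's `τ`/`σ`/`cc` exactly as any per-leg constant):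

* §1 `wtPrescribedSum_le_pinnedLabelSum` — generic family: the `(E, τ)`-prescribed weighted sum `≤` the one-pinned weighted sum at `(y, τ q)` (filter inclusion +
  the relabelling `X = (x, σ)`, `kernel_map_sectorAnalysis`, `image_latticeLegPos_eq_image_pos`);
* §2 **`towerInput_wtPrescribed_le_klTowerMeasWtAt`** — the all-known rows' `hB` for `G = 𝒱_{dk}` at `F_{dk−1}`, any rate `j`, with `B (m′+1) Fc := klTowerMeasWtAt … d k j (2(m′+1))`;
* §3 **`towerInputZero_wtPrescribed_le_klTowerUVWt`** — block `0`'s `hB` (trivial family, any rate `J′`) with `B (m′+1) Fc := klTowerUVWt … (2(m′+1))` (`klScaleWt_{J′} ≤ klScaleWt_0`);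
* §4 (appended) **`towerInputZero_prescribed_le_klTowerUVLev`** — block `0`, PLAIN tracks (levelled rows): `hB` with `B (m′+1) Fc := klTowerUVLev … (2(m′+1))`.
Pure bookkeeping over landed carriers; nothing about the model is asserted; nothing asserts (ℓ), any stub, K3 or superconductivity.
References: BGM 2006 §2.8 (2.76)–(2.77), (2.88)–(2.90) [cite: BenfattoGiulianiMastropietro2006].
-/

noncomputable section

namespace Summit.HubbardSuperconductivity.HubbardSuperconductivity.Theorems.EngineV8

set_option linter.dupNamespace false -- summit = problem name (single-conjunct summit), D-0017

open Classical
open Real Finset Literature.MathematicalPhysics.QuantumLattice Literature.Probability.LatticeModels GrassmannAlgebra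
open Summit.HubbardSuperconductivity.HubbardSuperconductivity.Theorems.KLProgrammeLegKernels
open Summit.HubbardSuperconductivity.HubbardSuperconductivity.Theorems.KLRegimeSplit
open Summit.HubbardSuperconductivity.HubbardSuperconductivity.Theorems.KLRegimeWick
open Summit.HubbardSuperconductivity.HubbardSuperconductivity.Theorems.TwoPointAssembly

variable {L M : ℕ} [NeZero L]

/-! ## §1 A prescribed weighted sum is a sub-sum of the one-pinned weighted sum -/

/-- **Prescribing more labels only drops terms**: for any family `F`, any `T`, rate `j`, a leg set `E ∋ q` with prescription `τ` and a pin `y`,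
`ε^m·Σ_{σ : σ|_E = τ|_E} Σ_{x : x q = y} klScaleWt_j(latticeLegPos ∘ (x, σ))·‖W^{F}_σ(T)(x)‖ ≤ ε^m·Σ_{X : X q = (y, τ q)} klScaleWt_j(latticeLegPos ∘ X)·‖kernel (map E(F)) T (m+1) X‖`. -/
theorem wtPrescribedSum_le_pinnedLabelSum {N : ℕ} {β : ℝ} (hβ : 0 ≤ β) (F : Fin N → FreqMomentum L M → ℂ) (T : HubbardGrassmann L M) (j m : ℕ)
    (E : Finset (Fin (m + 1))) (τ : Fin (m + 1) → SectorLeg N) {q : Fin (m + 1)} (hq : q ∈ E) (y : SpaceTimeIdx L M) :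
    imagTimeWeight β M ^ m *
        ∑ σ ∈ univ.filter (fun σ : Fin (m + 1) → SectorLeg N => ∀ e ∈ E, σ e = τ e),
          ∑ x ∈ univ.filter (fun x : Fin (m + 1) → SpaceTimeIdx L M => x q = y),
            klScaleWt L M β j ((univ.image fun i => (x i, σ i)).image (latticeLegPos (2 * (2 * M)))) * ‖sectorisedKernel L M β F T (m + 1) σ x‖ ≤
      imagTimeWeight β M ^ m *
        ∑ X ∈ univ.filter (fun X : Fin (m + 1) → SpaceTimeIdx L M × SectorLeg N => X q = (y, τ q)),
          klScaleWt L M β j ((univ.image X).image (latticeLegPos (2 * (2 * M)))) *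
            ‖kernel ℂ (ExteriorAlgebra.map (Matrix.toLin' (sectorAnalysisMatrix L M β F)) T) (m + 1) X‖ := by
  have hε : 0 ≤ imagTimeWeight β M := imagTimeWeight_nonneg hβ M
  refine mul_le_mul_of_nonneg_left ?_ (pow_nonneg hε m)
  -- relabel the one-pinned sum as a label-then-position double sum
  have hR : ∑ X ∈ univ.filter (fun X : Fin (m + 1) → SpaceTimeIdx L M × SectorLeg N => X q = (y, τ q)),
        klScaleWt L M β j ((univ.image X).image (latticeLegPos (2 * (2 * M)))) *
          ‖kernel ℂ (ExteriorAlgebra.map (Matrix.toLin' (sectorAnalysisMatrix L M β F)) T) (m + 1) X‖ =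
      ∑ σ ∈ univ.filter (fun σ : Fin (m + 1) → SectorLeg N => σ q = τ q),
        ∑ x ∈ univ.filter (fun x : Fin (m + 1) → SpaceTimeIdx L M => x q = y),
          klScaleWt L M β j ((univ.image fun i => (x i, σ i)).image (latticeLegPos (2 * (2 * M)))) * ‖sectorisedKernel L M β F T (m + 1) σ x‖ := by
    rw [← sum_pinned_prod_eq (fun x σ =>
      klScaleWt L M β j ((univ.image fun i => (x i, σ i)).image (latticeLegPos (2 * (2 * M)))) * ‖sectorisedKernel L M β F T (m + 1) σ x‖) q y (τ q)]
    refine sum_congr rfl fun Y _ => ?_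
    rw [kernel_map_sectorAnalysis]
  rw [hR]
  -- the prescribed labels are a subset of the one-pinned labels
  refine sum_le_sum_of_subset_of_nonneg (fun σ hσ => ?_) fun σ _ _ =>
    sum_nonneg fun x _ => mul_nonneg (zero_le_one.trans (one_le_klScaleWt L M β j _)) (norm_nonneg _)
  simp only [mem_filter, mem_univ, true_and] at hσ ⊢
  exact hσ q hq

/-! ## §2 Blocks `k ≥ 1`: the all-known rows' input hypothesis from `klTowerMeasWtAt` -/

/-- **THE WEIGHTED PRESCRIBED INPUT SIZES OF `𝒱_{dk}` AT `F_{dk−1}` ARE SERVED BY THE ONE-PINNED MEASURED ARRAY** — the literal `hB` of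
`pinnedTupleWtSum_klTowerIncr_le` / `klTowerBornWtFull_le_kit(_units)` with `B (m′+1) Fc := klTowerMeasWtAt L M β U μ K d k j (2(m′+1))` (every `Fc`, any rate `j`). -/
theorem towerInput_wtPrescribed_le_klTowerMeasWtAt [NeZero M] {β : ℝ} (hβ : 0 ≤ β) (U μ : ℝ) (K : TrigPolyC4v) (d k j : ℕ)
    (m' Fc : ℕ) (E : Finset (Fin (2 * m' + 1 + 1))) (τ : Fin (2 * m' + 1 + 1) → SectorLeg (sectorCount (d * k - 1)))
    (q : Fin (2 * m' + 1 + 1)) (hq : q ∈ E) (_hE : E.card = Fc + 1) (y : SpaceTimeIdx L M) :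
    imagTimeWeight β M ^ (2 * m' + 1) *
        ∑ σ ∈ univ.filter (fun σ : Fin (2 * m' + 1 + 1) → SectorLeg (sectorCount (d * k - 1)) => ∀ e ∈ E, σ e = τ e),
          ∑ x ∈ univ.filter (fun x : Fin (2 * m' + 1 + 1) → SpaceTimeIdx L M => x q = y),
            klScaleWt L M β j ((univ.image fun i => (x i, σ i)).image (latticeLegPos (2 * (2 * M)))) *
              ‖sectorisedKernel L M β (klAnisoFamily L M β μ K klE0 (d * k - 1)) (klTowerInput L M β U μ K d k) (2 * m' + 1 + 1) σ x‖ ≤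
      klTowerMeasWtAt L M β U μ K d k j (2 * (m' + 1)) := by
  refine (wtPrescribedSum_le_pinnedLabelSum hβ _ _ j (2 * m' + 1) E τ hq y).trans ?_
  rw [show 2 * (m' + 1) = 2 * m' + 1 + 1 by ring]
  exact klWtPinnedSumAt_le_klTowerMeasWtAt β U μ K d k j (2 * m' + 1 + 1) q (y, τ q)

/-! ## §3 Block `0`: the all-known rows' input hypothesis from the UV datum `klTowerUVWt` -/

/-- **BLOCK `0`: THE WEIGHTED PRESCRIBED PLAIN INPUT SIZES OF `𝒱_0` ARE SERVED BY E1's UV DATUM** — the literal `hB` of `pinnedTupleWtSum_klTowerIncr_zero_le_kit` /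
`klTowerBornWtFull_zero_le_kit(_units)` (trivial family, any rate `J′`; the weight only decreases with the rate, `klScaleWt_le_of_le`) with
`B (m′+1) Fc := klTowerUVWt L M β U μ K (2(m′+1))`. -/
theorem towerInputZero_wtPrescribed_le_klTowerUVWt [NeZero M] {β : ℝ} (hβ : 0 ≤ β) (U μ : ℝ) (K : TrigPolyC4v) (J' : ℕ)
    (m' Fc : ℕ) (E : Finset (Fin (2 * m' + 1 + 1))) (τ : Fin (2 * m' + 1 + 1) → SectorLeg 1)
    (q : Fin (2 * m' + 1 + 1)) (hq : q ∈ E) (_hE : E.card = Fc + 1) (y : SpaceTimeIdx L M) :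
    imagTimeWeight β M ^ (2 * m' + 1) *
        ∑ σ ∈ univ.filter (fun σ : Fin (2 * m' + 1 + 1) → SectorLeg 1 => ∀ e ∈ E, σ e = τ e),
          ∑ x ∈ univ.filter (fun x : Fin (2 * m' + 1 + 1) → SpaceTimeIdx L M => x q = y),
            klScaleWt L M β J' ((univ.image fun i => (x i, σ i)).image (latticeLegPos (2 * (2 * M)))) *
              ‖sectorisedKernel L M β (trivialMultiplier L M) (klEffectiveAction L M β U μ K klE0 0) (2 * m' + 1 + 1) σ x‖ ≤
      klTowerUVWt L M β U μ K (2 * (m' + 1)) := by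
  have hε : 0 ≤ imagTimeWeight β M := imagTimeWeight_nonneg hβ M
  refine (wtPrescribedSum_le_pinnedLabelSum hβ _ _ J' (2 * m' + 1) E τ hq y).trans ?_
  -- rate `J′ ≥ 0`: the weight only decreases
  refine le_trans (mul_le_mul_of_nonneg_left (sum_le_sum fun X _ =>
    mul_le_mul_of_nonneg_right (klScaleWt_le_of_le β (Nat.zero_le J') _) (norm_nonneg _)) (pow_nonneg hε _)) ?_
  have h := uvWtPinnedSum_le_klTowerUVWt β U μ K (2 * m' + 1 + 1) q (y, τ q)
  rw [show 2 * (m' + 1) = 2 * m' + 1 + 1 by ring]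
  simpa only [Nat.add_sub_cancel] using h

/-! ## §4 (appended) Block `0`, plain tracks: the levelled / plain rows' input hypothesis from the UV datum `klTowerUVLev` -/

/-- **BLOCK `0`: THE PLAIN PRESCRIBED INPUT SIZES OF `𝒱_0` ARE SERVED BY E1's PLAIN UV DATUM** — the literal `hB` of `klLevNormOf_klTowerIncr_zero_le_kit` /
`klTowerBornLev_zero_le_kit(_units)` (trivial family, all tuples) with `B (m′+1) Fc := klTowerUVLev L M β U μ K (2(m′+1))`: the `(E, τ)`-prescribed plain sum is a
sub-sum of the leg sum `sectorLegSum` at `(q, τ q, y)`, which the sectorised `L¹–L^∞` norm dominates (`sectorLegSum_le_sectorisedKernelNorm`). -/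
theorem towerInputZero_prescribed_le_klTowerUVLev [NeZero M] {β : ℝ} (hβ : 0 ≤ β) (U μ : ℝ) (K : TrigPolyC4v)
    (m' Fc : ℕ) (E : Finset (Fin (2 * m' + 1 + 1))) (τ : Fin (2 * m' + 1 + 1) → SectorLeg 1)
    (q : Fin (2 * m' + 1 + 1)) (hq : q ∈ E) (_hE : E.card = Fc + 1) (y : SpaceTimeIdx L M) :
    imagTimeWeight β M ^ (2 * m' + 1) *
        ∑ σ ∈ univ.filter (fun σ : Fin (2 * m' + 1 + 1) → SectorLeg 1 => ∀ e ∈ E, σ e = τ e),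
          ∑ x ∈ univ.filter (fun x : Fin (2 * m' + 1 + 1) → SpaceTimeIdx L M => x q = y),
            ‖sectorisedKernel L M β (trivialMultiplier L M) (klEffectiveAction L M β U μ K klE0 0) (2 * m' + 1 + 1) σ x‖ ≤
      klTowerUVLev L M β U μ K (2 * (m' + 1)) := by
  have hε : 0 ≤ imagTimeWeight β M := imagTimeWeight_nonneg hβ M
  rw [show 2 * (m' + 1) = 2 * m' + 1 + 1 by ring, klTowerUVLev, hubbardSectorKernelNorm_def]
  refine le_trans ?_ (sectorLegSum_le_sectorisedKernelNorm (imagTimeWeight β M) _ _ q (τ q) y)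
  rw [sectorLegSum_def, ← mul_sum]
  refine mul_le_mul_of_nonneg_left ?_ (pow_nonneg hε _)
  refine sum_le_sum_of_subset_of_nonneg (fun σ hσ => ?_) fun _ _ _ => sum_nonneg fun _ _ => norm_nonneg _
  simp only [mem_filter, mem_univ, true_and] at hσ ⊢
  exact hσ q hq

end Summit.HubbardSuperconductivity.HubbardSuperconductivity.Theorems.EngineV8

end
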